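import Summits.Langlands.Langlands.Theses.ExteriorSquareAscent

/-!
# Disproof of `ReducibleInducesSquare` (stmt-Langlands-18054) — findings

Standing disprover work file (cdisprove, cycle 1, `refuter-cdisprove-stmt-Langlands-18054-0`,
2026-08-17).  Prose lives in docstrings; every `theorem` below is sorry-free and kernel-checked.

## Verdict: NO KILL — and none can exist short of a counterexample to "cuspidal ⇒ irreducible"

* **F1 (logical position).**  The crux is an implication whose antecedent is
  "`π` cuspidal on GL₄/K with a Hecke field, not ess. self-dual, not quadratically self-twisted,
  and a SEMISIMPLE, a.e.-compatible `ρ : Γ_K → GL₄(ℚ̄_ℓ)` that is REDUCIBLE".  Modulo the route's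
  own lever `InducedSquareAscent` (crux 2) the crux is EQUIVALENT to the emptiness of that
  antecedent (`reducibleInducesSquare_iff_noReducibleCompatibleAvatar`, proved below = the logic
  of `closes`).  Emptiness of the antecedent is an instance of the folklore conjecture
  "cuspidal ⇒ irreducible" (`CuspidalImpliesIrreducibleGL4`), so every refutation of the crux is a
  cuspidal `π` on GL₄ with a reducible compatible avatar — kill criterion (1) of the route, i.e. a
  counterexample to clause (A) of the summit philosophy.  Not available; not searched for by
  computation (no finite content: `CuspidalAutomorphicRepData` is a subquotient of genuine cusp
  forms, `FramedGaloisRep` a genuine continuous homomorphism — no junk inhabitant, cf. VETTING.md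
  of rattack-0, confirmed).
* **F2 (load-bearing analysis, formal).**  Dropping ANY ONE of the four named hypotheses
  `HeckeField`, `¬EssSelfDual`, `¬SelfTwisted`, `IsSemisimple` leaves a statement that is STILL
  implied by `CuspidalImpliesIrreducibleGL4` (`without*_of_conjecture` below).  Hence no
  `_false_without_<H>` theorem can be landed for these four unless the conjecture fails: they are
  load-bearing for the PROOF (Böckle–Hui needs E-rationality = Hecke field; Asgari–Raghuram
  cuspidality of `∧²π` needs `¬`esd ∧ `¬`self-twist; the 2+2 / 3+1 split needs semisimplicity),
  not for TRUTH.  The two hypotheses load-bearing for truth are (a) `¬ IsIrreducible`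
  (`WithoutReducible` is false for a generic `π`: `∧²π` cuspidal and not induced) and (b) the
  cuspidality baked into the TYPE of `π` (isobaric `f ⊞ g`, `f`, `g` non-dihedral weight-2 newforms
  with `ω_f ≠ ω_g`, `g ≄ f ⊗ ν`: `ρ_f ⊕ ρ_g` is a reducible compatible avatar, `π` is neither esd nor
  self-twisted, and `∧²π = ω_f ⊞ ω_g ⊞ f ⊠ g` is not `AI_{L/K}(P)` for cuspidal `P` by JS isobaric
  uniqueness) — both witnesses are genuine automorphic representations, NOT constructible in Lean,
  so neither negative lemma is landable.  Nothing is proposed under `Theorems/…/Negative/` this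
  cycle (anti-leakage: no free-standing side lemmas).
* **F3 (misstatement audit — passes).**  Read back symbol by symbol (W.lean rc 0):
  `arithFrobPolyOfSatake ι q 4 α = ∏ (X − ι⁻¹((q^{3/2}a)⁻¹))` (ARITHMETIC Frobenius; dictionary is
  `ρ ↔ π` in the HLTT C-normalisation; all crux predicates are contragredient/twist-invariant);
  Hecke-field exponents `q^{i(4−i)/2}` make the Frobenius char-poly E-rational
  (`q^{3i/2}e_i = q^{i(i−1)/2}·(q^{i(4−i)/2}e_i)`), as BH needs; ess-self-duality quantifies over
  ALL GL₁ cuspidal data = all Hecke characters (tree dictionary), so `π ≅ π^∨ ⊗ η|·|^{it}` is also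
  excluded (needed for "no RS pole"); self-twist: any self-twist character has order ∣ 4 and yields
  a quadratic one, and quadratic Hecke characters are the class-field signs used (inertiaDeg = residue
  degree; ramified `v ↦ +1`, finitely many, absorbed by `cofinite`); AI dictionary: split
  `β₁ + β₂`, inert `{±√b}` — both correct for `AI_{L/K}(P)` w.r.t. `q_w`-normalised Satake data of
  `P`; ramified `v` of `L/K` fail the split clause (`w₁ ≠ w₂`) but are finitely many; `∃ hL3` is
  dischargeable (`isCompact_glFiniteIntegralLevel_holds 3 L`).  No normalisation slip found
  (kill criterion (3) second half: negative).
* **F4 (fine print of the printed route, resolved in favour of the provers).**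
  Ginzburg–Rallis 2000, Thm 3.2 (Compositio 123, p. 264, read from the materialised text):
  "Let π be a cusp form on GL₆(𝔸). Then `L^S(π, Λ³ ⊗ w, s)` is ENTIRE unless `ω_π²w⁴ = 1` and
  `ω_πw² ≠ 1`; in this case at most a simple pole at s = 0 or s = 1" — ANY number field, ANY
  unitary twist `w` (so the weight-0 but possibly infinite-order `η³χ⁻³` over CM K is forced
  quadratic, as Shavali uses it); enlarging `S` multiplies by polynomials in `q^{-s}` (GR, Remark
  after Thm 3.3, p. 265), so a pole of `L^{S'}` at 1 implies one of `L^{S}`: the a.e.-compatibility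
  set of the crux may be any cofinite set.  Asgari–Raghuram Thm 1 (arXiv:0712.4315 §1): any number
  field, (i) `∧²Π` not cuspidal ⇔ (iii) (α) ess. self-dual or (β) nontrivial self-twist.  Weight
  pinning: with `π ≅ π_u ⊗ |det|^{-t}`, `χ ↔ det σ`, `η ↔ det τ` (BH), strict JS on the CUSPIDAL
  unitary `Π_u = ∧²π_u` gives `|λ(ϖ_v)| ∈ (q^{-1}, q)` for `λ = η/χ`, hence weight(λ)/2 ∈ {−½, 0, ½}`;
  `t ∈ ¼ℤ` kills `±½` (parity of `w_χ + w_η = 12 − 8t`).  `t ∈ ½ℤ` follows from the crux's OWN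
  hypotheses (card `frobenius-trace-weight-parity`: `tr ρ(Frob_v) ≠ 0` on a positive-density set by
  continuity + Chebotarev, E-rationality of both `q^{3/2}e₁(α)` and `q^{-3/2}e₃(α)/e₄(α)`, unitarity
  `ē₁(u) = e₃(u)/e₄(u)` ⇒ `q_v^{2t} ∈ E` for infinitely many degree-one `v`, and `8t ∈ ℤ` from the
  algebraicity of `ω_π = e₄ ∈ E` ⇒ `4 ∣ 8t`) — I re-derived this and could not break it; so the
  earlier restatement request "insert `IsCAlgebraic`" (VETTING.md §6) is no longer needed, though
  still free (`closes` has `hCalg` in scope).  Yamana 2015 (Math. Z. 279) is paywalled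
  (acq-06557); it is needed only by the `birth` line's stub 2, not by the picked `Sketch` line.
* **F5 (the picked line, adversarially re-checked).**  Card `dual-pair-rankin-selberg-syzygy`:
  with `A = σ⊗σ^∨`, `B = τ⊗τ^∨`, `D = σ⊗τ`, `χ = det σ`, `λ = det τ/det σ` one has, term by term,
  `V = W = A ⊕ B ⊕ Aλ ⊕ Bλ ⊕ Dχ⁻¹λ⁻¹ ⊕ 4·Dχ⁻¹ ⊕ Dχ⁻¹λ ⊕ 2·1 ⊕ 2λ ⊕ λ⁻¹ ⊕ λ²` (hand expansion, this
  session) — a tautology of `R(GL₂ × GL₂ × T)`, so the Euler-product identity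
  `L(π×π^∨⊗λ)L(π×π^∨⊗λ²)L(Π⊗χ⁻¹λ)²ζ_K L(λ³) = L(π×(π⊗χ⁻¹λ))L(π^∨×(π^∨⊗χλ²))L(Π⊗χ⁻¹)L(Π⊗χ⁻¹λ²)L(λ)L(λ²)`
  holds a.e. for every (2,2)-split compatible `ρ`; every factor is twist-invariant (only `u_iu_j⁻¹`,
  `u_iu_j/(u_{s₁}u_{s₂})`, `λ` occur), and at β = 0 the pole orders at s = 1 are
  LHS ≥ 1 + [λ=1] + [λ²=1] + [λ³=1] (ζ_K; no LHS factor vanishes at 1: Shahidi/JS for GL₄×GL₄,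
  cuspidal GL₆ standard, unitary Hecke) versus RHS = [λ=1] + [λ²=1] exactly (RS pairs pole-free by
  `¬`esd; `L(Π⊗μ)` entire by cuspidality of `Π`).  SANITY MODEL (balances, as it must): isobaric
  `π = f ⊞ g` gives `4[λ=1] + 4[λ²=1] + 1 + [λ³=1]` on BOTH sides (the RHS recovers `ζ` inside
  `L(Π⊗χ⁻¹) ∋ L(ω_fχ⁻¹) = ζ` and the RS poles from `f^∨ ≅ f⊗ω_f⁻¹`).  I found no flaw: the (2,2)
  case is contradictory from BH + Kim + AR + JS/Shahidi alone, the crux's `∃ (L,P)` is then reached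
  ex falso, and GR/Yamana/`K'` are not needed.  Residual risks for the LEAD (not refutations):
  (i) the tree renderings of JS (2.2)/(2.3) for Borel–Jacquet data must allow the twelve twisted
  families above with a COMMON finite `S`; (ii) strict JS `q^{-1/2} < |u| < q^{1/2}` for cuspidal
  unitary GL₆ is not yet a tree fact; (iii) "GL₁ cuspidal data = all unitary Hecke characters incl.
  infinite order" is used in BOTH directions (to read `¬`esd for `μ = χ⁻¹λ|·|^{it}`).
* **F6 (targets).**  payload.targets = [] (no stuck stubs yet).  Registered skeleton `birth`
  (stubs `stub_noStableLine`, `stub_twoPlusTwoInducesSquare`) and the Galois-side stubs A–E of the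
  picked `Lines/Sketch.lean` (read at 12:00Z) all keep "cuspidal `π` (+ a compatible `ρ` of a
  reducible shape)" among their hypotheses, hence are implied by `CuspidalImpliesIrreducibleGL4`
  exactly like the crux: not refutable without a genuine `π`.  `stub_noStableLine` drops
  `¬`esd/`¬`self-twist — still fine (Shavali Prop 4.1 uses neither).  The two ANALYTIC stubs of
  `Sketch.lean` were re-derived by hand this session and NOT broken:
  `stub_noLineAnalytic` ((3,1): `t = {m,b,c,d}`, eight-term identity
  `{b,c,d}/m ⊔ {bc,bd,cd}/m² ⊔ {bcd/m³} ⊔ {1}` on both sides — checked; with `|m| = q^{-d}` the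
  shifts are `−2d, −4d, 0 | −3d, −d`, one-signed, so after the contragredient flip `d ≤ 0` the left
  side diverges at `s → 1⁺` by absolute convergence + Hecke's pole while the right side stays finite
  — no weight pinning, no `¬`esd needed) and `stub_noPlanesAnalytic` ((2,2): the 46-term identity
  needs only `β⁻¹ = (∏β)⁻¹·β` for `|β| = 2`, so it holds for ANY a.e. splitting `t_π = β ⊔ γ` with
  `∏β = χ(ϖ)`; with `|χ(ϖ)| = q^{κ}` the shifts are `2κ,4κ,3κ,0,6κ | 3κ,3κ,κ,5κ,2κ,4κ`, one-signed;
  `β ↔ γ` flips `κ ↦ −κ`; for `κ > 0` absolute convergence alone contradicts Hecke's pole, for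
  `κ = 0` the pole count of F5 applies with `λ = ωχ⁻²` automatically unitary).  So the weight /
  `IsCAlgebraic` objection of VETTING.md is dissolved for this line, and strict JS is used only
  through `κ ∈ (−½, ½)` (not even needed).  Residual exposure of the line = its three fact-stubs
  (JS (2.2)/(2.3) renderings for Borel–Jacquet data, AR (i)⇒(iii) Satake form) — tree facts with
  their own discharge programme, outside this crux.

## What would change the verdict
A cuspidal `π` on GL₄ over some `K` with a reducible compatible semisimple `ρ` (any `ℓ`, `ι`).
Candidate families checked on paper and why they do not bite: monomial `AI_{M/K}(χ)` (ρ = Ind χ is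
irreducible iff π cuspidal, Mackey; and Chebotarev + Brauer–Nesbitt pin every compatible semisimple
`ρ'` to `ρ`); `Sym³ f`, `f ⊠ g`, `As(f)`, GSp₄-transfers (ess. self-dual — excluded, and their
avatars are irreducible anyway when π is cuspidal); Eisenstein/isobaric `f ⊞ g`, `𝟙 ⊗ χ`
(not cuspidal — excluded by the type; `𝟙⊗χ` is moreover ess. self-dual).
-/

namespace Summit.Langlands.Langlands.Cruxes.ReducibleInducesSquare.Disproof

open Summit.Langlands.Langlands.Theses.ExteriorSquareAscent
open Literature.NumberTheory.Automorphic Literature.NumberTheory.GaloisRepresentations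
open IsDedekindDomain
open scoped NumberField Classical

set_option linter.dupNamespace false

noncomputable section

/-! ## §0  The hypothesis blocks of the crux, verbatim (certified by `Iff.rfl` in §1) -/

/-- Hecke-field hypothesis of the crux (Clozel's `E`-rationality in the C-normalisation
`q_v^{i(4-i)/2} e_i(α_v) ∈ E`), verbatim. [folklore] -/
def HeckeFieldHyp {K : Type} [Field K] [NumberField K] {hcpt : isCompact_glFiniteIntegralLevel 4 K}
    (π : CuspidalAutomorphicRepData 4 K hcpt) : Prop :=
  ∃ E : Subfield ℂ, FiniteDimensional ℚ E ∧ ∀ᶠ v in Filter.cofinite, ∀ α : Multiset ℂ,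
    π.1.HasSatakeParamAt v α →
      ∀ i ≤ 4, ((((Real.sqrt (v.residueCard : ℝ)) : ℝ) : ℂ) ^ (i * (4 - i))) * α.esymm i ∈ E

/-- "`π` is essentially self-dual at Satake level" (`∃` GL₁ datum `η`, `t_(π,v)⁻¹ = η_v t_(π,v)`
a.e.), verbatim from the crux. [folklore] -/
def EssSelfDualHyp {K : Type} [Field K] [NumberField K] (h1 : isCompact_glFiniteIntegralLevel 1 K)
    {hcpt : isCompact_glFiniteIntegralLevel 4 K} (π : CuspidalAutomorphicRepData 4 K hcpt) : Prop :=
  ∃ η : CuspidalAutomorphicRepData 1 K h1, ∀ᶠ v in Filter.cofinite, ∀ α : Multiset ℂ,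
    π.1.HasSatakeParamAt v α →
      ∃ e : ℂ, η.1.HasSatakeParamAt v {e} ∧ α.map (fun a => a⁻¹) = α.map (fun a => e * a)

/-- "`π` is self-twisted by the class-field sign of some quadratic `L'/K` a.e.", verbatim. [folklore] -/
def SelfTwistedHyp {K : Type} [Field K] [NumberField K] {hcpt : isCompact_glFiniteIntegralLevel 4 K}
    (π : CuspidalAutomorphicRepData 4 K hcpt) : Prop :=
  ∃ (L' : Type) (_ : Field L') (_ : NumberField L') (_ : Algebra K L'), Module.finrank K L' = 2 ∧
    ∀ᶠ v : HeightOneSpectrum (𝓞 K) in Filter.cofinite, ∀ α : Multiset ℂ, π.1.HasSatakeParamAt v α →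
      α.map (fun a => (if ∃ w : HeightOneSpectrum (𝓞 L'), w.asIdeal.under (𝓞 K) = v.asIdeal ∧
        w.asIdeal.inertiaDeg (𝓞 K) = 1 then (1 : ℂ) else -1) * a) = α

/-- A.e. Satake–Frobenius compatibility of `(π, ι)` with `ρ` (C-normalisation
`arithFrobPolyOfSatake ι q_v 4`), verbatim. [folklore] -/
def CompatibleHyp {K : Type} [Field K] [NumberField K] {hcpt : isCompact_glFiniteIntegralLevel 4 K}
    (π : CuspidalAutomorphicRepData 4 K hcpt) {ℓ : ℕ} [Fact ℓ.Prime] (ι : PadicAlgCl ℓ ≃+* ℂ)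
    (ρ : FramedGaloisRep K (PadicAlgCl ℓ) 4) : Prop :=
  ∀ᶠ v : HeightOneSpectrum (𝓞 K) in Filter.cofinite, ∃ α : Multiset ℂ, π.1.HasSatakeParamAt v α ∧
    ρ.IsUnramifiedAt v ∧ ρ.HasFrobCharpolyAt v (arithFrobPolyOfSatake ι v.residueCard 4 α)

/-- The crux's conclusion: `∧²`-Satake data of `π` = `AI_{L/K}(P)`-Satake data a.e. for some
quadratic field extension `L/K` and cuspidal `P` on GL₃/L, verbatim. [folklore] -/
def AIConclusion {K : Type} [Field K] [NumberField K] {hcpt : isCompact_glFiniteIntegralLevel 4 K}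
    (π : CuspidalAutomorphicRepData 4 K hcpt) : Prop :=
  ∃ (L : Type) (_ : Field L) (_ : NumberField L) (_ : Algebra K L), Module.finrank K L = 2 ∧
    ∃ (hL3 : isCompact_glFiniteIntegralLevel 3 L) (P : CuspidalAutomorphicRepData 3 L hL3),
      ∀ᶠ v : HeightOneSpectrum (𝓞 K) in Filter.cofinite, ∀ α : Multiset ℂ, π.1.HasSatakeParamAt v α →
        ((∃ w : HeightOneSpectrum (𝓞 L), w.asIdeal.under (𝓞 K) = v.asIdeal ∧
            w.asIdeal.inertiaDeg (𝓞 K) = 1) →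
          ∃ w₁ w₂ : HeightOneSpectrum (𝓞 L), w₁ ≠ w₂ ∧ w₁.asIdeal.under (𝓞 K) = v.asIdeal ∧
            w₂.asIdeal.under (𝓞 K) = v.asIdeal ∧ ∃ β₁ β₂ : Multiset ℂ, P.1.HasSatakeParamAt w₁ β₁ ∧
              P.1.HasSatakeParamAt w₂ β₂ ∧ (α.powersetCard 2).map Multiset.prod = β₁ + β₂) ∧
        ((¬ ∃ w : HeightOneSpectrum (𝓞 L), w.asIdeal.under (𝓞 K) = v.asIdeal ∧
            w.asIdeal.inertiaDeg (𝓞 K) = 1) →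
          ∃ w : HeightOneSpectrum (𝓞 L), w.asIdeal.under (𝓞 K) = v.asIdeal ∧ ∃ β γ : Multiset ℂ,
            P.1.HasSatakeParamAt w β ∧ γ.map (fun c => c ^ 2) = β ∧
              (α.powersetCard 2).map Multiset.prod = γ + γ.map (fun c => -c))

/-! ## §1  Logical position of the crux -/

/-- The crux in block form; `Iff.rfl` certifies that §0 is a verbatim transcription. [folklore] -/
theorem reducibleInducesSquare_iff_blocks :
    ReducibleInducesSquare ↔
      ∀ (K : Type) [Field K] [NumberField K] (h1 : isCompact_glFiniteIntegralLevel 1 K)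
        (hcpt : isCompact_glFiniteIntegralLevel 4 K) (π : CuspidalAutomorphicRepData 4 K hcpt),
        HeckeFieldHyp π → ¬ EssSelfDualHyp h1 π → ¬ SelfTwistedHyp π →
          ∀ (ℓ : ℕ) [Fact ℓ.Prime] (ι : PadicAlgCl ℓ ≃+* ℂ) (ρ : FramedGaloisRep K (PadicAlgCl ℓ) 4),
            ρ.toGaloisRep.IsSemisimple → CompatibleHyp π ι ρ → ¬ ρ.toGaloisRep.IsIrreducible →
              AIConclusion π :=
  Iff.rfl

/-- **Emptiness of the crux's antecedent**: no cuspidal `π` on GL₄/K with a Hecke field, not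
ess. self-dual and not quadratically self-twisted, admits a reducible semisimple a.e.-compatible
`ρ`.  This is the route's target `IrreducibleGL4` WITHOUT its `IsCAlgebraic` hypothesis (the crux
does not carry it either). Conjectural ("cuspidal ⇒ irreducible"); every refutation of the crux is a
refutation of this. [conjecture; cf. Shavali arXiv:2603.19768 §1 "irreducibility conjecture"] -/
def NoReducibleCompatibleAvatar : Prop :=
  ∀ (K : Type) [Field K] [NumberField K] (h1 : isCompact_glFiniteIntegralLevel 1 K)
    (hcpt : isCompact_glFiniteIntegralLevel 4 K) (π : CuspidalAutomorphicRepData 4 K hcpt),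
    HeckeFieldHyp π → ¬ EssSelfDualHyp h1 π → ¬ SelfTwistedHyp π →
      ∀ (ℓ : ℕ) [Fact ℓ.Prime] (ι : PadicAlgCl ℓ ≃+* ℂ) (ρ : FramedGaloisRep K (PadicAlgCl ℓ) 4),
        ρ.toGaloisRep.IsSemisimple → CompatibleHyp π ι ρ → ρ.toGaloisRep.IsIrreducible

/-- Ex falso: emptiness of the antecedent proves the crux (so the picked `Sketch` line, which
derives `False` in both reducible shapes, does close the crux as filed). [folklore] -/
theorem reducibleInducesSquare_of_noReducibleCompatibleAvatar (h : NoReducibleCompatibleAvatar) :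
    ReducibleInducesSquare := by
  intro K _ _ h1 hcpt π hE hNE hST ℓ _ ι ρ hss hcomp hred
  exact absurd (h K h1 hcpt π hE hNE hST ℓ ι ρ hss hcomp) hred

/-- Conversely, GIVEN the route's lever (crux 2 `InducedSquareAscent`), the crux implies the
emptiness of its own antecedent — the propositional content of `closes` minus crux 4.  Hence,
modulo crux 2, crux 3 is EXACTLY as strong as irreducibility for this class of `π`. [folklore] -/
theorem noReducibleCompatibleAvatar_of_ascent (h2 : InducedSquareAscent)
    (h3 : ReducibleInducesSquare) : NoReducibleCompatibleAvatar := by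
  intro K _ _ h1 hcpt π hE hNE hST ℓ _ ι ρ hss hcomp
  by_contra hirr
  obtain ⟨L, _, _, _, hdeg, hL3, P, hind⟩ := h3 K h1 hcpt π hE hNE hST ℓ ι ρ hss hcomp hirr
  rcases h2 K h1 hcpt π L hdeg hL3 P hind with hsd | hst
  · exact hNE hsd
  · exact hST hst

/-- Modulo crux 2 the crux is equivalent to the emptiness of its antecedent. [folklore] -/
theorem reducibleInducesSquare_iff_noReducibleCompatibleAvatar (h2 : InducedSquareAscent) :
    ReducibleInducesSquare ↔ NoReducibleCompatibleAvatar :=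
  ⟨noReducibleCompatibleAvatar_of_ascent h2, reducibleInducesSquare_of_noReducibleCompatibleAvatar⟩

/-- **Folklore "cuspidal ⇒ irreducible" for GL₄ at Satake level** (strong form: no Hecke field,
no algebraicity, no semisimplicity — a representation whose semisimplification is irreducible is
irreducible, and for non-arithmetic `π` no compatible `ρ` is expected at all).  Stated only to make
the load-bearing analysis of §2 formal: a `_false_without_<H>` theorem for any of the four named
hypotheses would refute THIS. [conjecture; Ramakrishnan, "Irreducibility and cuspidality" (2008) §1;
Shavali arXiv:2603.19768 §1] -/
def CuspidalImpliesIrreducibleGL4 : Prop :=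
  ∀ (K : Type) [Field K] [NumberField K] (hcpt : isCompact_glFiniteIntegralLevel 4 K)
    (π : CuspidalAutomorphicRepData 4 K hcpt) (ℓ : ℕ) [Fact ℓ.Prime] (ι : PadicAlgCl ℓ ≃+* ℂ)
    (ρ : FramedGaloisRep K (PadicAlgCl ℓ) 4), CompatibleHyp π ι ρ → ρ.toGaloisRep.IsIrreducible

/-- The conjecture implies the emptiness of the crux's antecedent (hence the crux). [folklore] -/
theorem noReducibleCompatibleAvatar_of_conjecture (h : CuspidalImpliesIrreducibleGL4) :
    NoReducibleCompatibleAvatar :=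
  fun K _ _ _ hcpt π _ _ _ ℓ _ ι ρ _ hcomp => h K hcpt π ℓ ι ρ hcomp

/-- … and therefore the crux itself: `ReducibleInducesSquare` is conjecturally VACUOUSLY true.
[folklore] -/
theorem reducibleInducesSquare_of_conjecture (h : CuspidalImpliesIrreducibleGL4) :
    ReducibleInducesSquare :=
  reducibleInducesSquare_of_noReducibleCompatibleAvatar (noReducibleCompatibleAvatar_of_conjecture h)

/-! ## §2  Load-bearing analysis ("any proof must use H" vs "H is needed for truth")

For each named hypothesis `H` of the crux, `ReducibleInducesSquareWithout<H>` is the crux with `H`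
dropped.  VERDICT for `H ∈ {HeckeField, NotEssSelfDual, NotSelfTwisted, Semisimple}`: still implied
by `CuspidalImpliesIrreducibleGL4` (theorems below), so NOT refutable — no `_false_without_<H>`
can be landed; these hypotheses are load-bearing only for the intended proofs (BH / AR / the split
into 3+1 and 2+2).  VERDICT for `H = Reducible` and for the cuspidality in the type of `π`:
mathematically FALSE without them, but each witness is a genuine automorphic representation of
GL₄ (resp. an isobaric `f ⊞ g`), not constructible in this tree — no theorem is claimed. -/

/-- The crux without `¬ SelfTwisted`. Not refutable (see `withoutNotSelfTwisted_of_conjecture`);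
`¬`self-twist is used in the proof only through Asgari–Raghuram (cuspidality of `∧²π`). [folklore] -/
def ReducibleInducesSquareWithoutNotSelfTwisted : Prop :=
  ∀ (K : Type) [Field K] [NumberField K] (h1 : isCompact_glFiniteIntegralLevel 1 K)
    (hcpt : isCompact_glFiniteIntegralLevel 4 K) (π : CuspidalAutomorphicRepData 4 K hcpt),
    HeckeFieldHyp π → ¬ EssSelfDualHyp h1 π →
      ∀ (ℓ : ℕ) [Fact ℓ.Prime] (ι : PadicAlgCl ℓ ≃+* ℂ) (ρ : FramedGaloisRep K (PadicAlgCl ℓ) 4),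
        ρ.toGaloisRep.IsSemisimple → CompatibleHyp π ι ρ → ¬ ρ.toGaloisRep.IsIrreducible →
          AIConclusion π

/-- The crux without `¬ EssSelfDual`. Not refutable; `¬`esd is used through Asgari–Raghuram and,
in the picked `Sketch` line, to forbid poles of `L(s, π × (π ⊗ μ))`. [folklore] -/
def ReducibleInducesSquareWithoutNotEssSelfDual : Prop :=
  ∀ (K : Type) [Field K] [NumberField K]
    (hcpt : isCompact_glFiniteIntegralLevel 4 K) (π : CuspidalAutomorphicRepData 4 K hcpt),
    HeckeFieldHyp π → ¬ SelfTwistedHyp π →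
      ∀ (ℓ : ℕ) [Fact ℓ.Prime] (ι : PadicAlgCl ℓ ≃+* ℂ) (ρ : FramedGaloisRep K (PadicAlgCl ℓ) 4),
        ρ.toGaloisRep.IsSemisimple → CompatibleHyp π ι ρ → ¬ ρ.toGaloisRep.IsIrreducible →
          AIConclusion π

/-- The crux without the Hecke field. Not refutable; the Hecke field is used for Böckle–Hui
(E-rationality of `ρ`, `∧²ρ`, `det ρ`) and for the weight-parity pinning `t ∈ ½ℤ`. [folklore] -/
def ReducibleInducesSquareWithoutHeckeField : Prop :=
  ∀ (K : Type) [Field K] [NumberField K] (h1 : isCompact_glFiniteIntegralLevel 1 K)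
    (hcpt : isCompact_glFiniteIntegralLevel 4 K) (π : CuspidalAutomorphicRepData 4 K hcpt),
    ¬ EssSelfDualHyp h1 π → ¬ SelfTwistedHyp π →
      ∀ (ℓ : ℕ) [Fact ℓ.Prime] (ι : PadicAlgCl ℓ ≃+* ℂ) (ρ : FramedGaloisRep K (PadicAlgCl ℓ) 4),
        ρ.toGaloisRep.IsSemisimple → CompatibleHyp π ι ρ → ¬ ρ.toGaloisRep.IsIrreducible →
          AIConclusion π

/-- The crux without semisimplicity of `ρ`. Not refutable (a compatible `ρ` has compatible
semisimplification; irreducible semisimplification ⇒ irreducible). [folklore] -/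
def ReducibleInducesSquareWithoutSemisimple : Prop :=
  ∀ (K : Type) [Field K] [NumberField K] (h1 : isCompact_glFiniteIntegralLevel 1 K)
    (hcpt : isCompact_glFiniteIntegralLevel 4 K) (π : CuspidalAutomorphicRepData 4 K hcpt),
    HeckeFieldHyp π → ¬ EssSelfDualHyp h1 π → ¬ SelfTwistedHyp π →
      ∀ (ℓ : ℕ) [Fact ℓ.Prime] (ι : PadicAlgCl ℓ ≃+* ℂ) (ρ : FramedGaloisRep K (PadicAlgCl ℓ) 4),
        CompatibleHyp π ι ρ → ¬ ρ.toGaloisRep.IsIrreducible → AIConclusion π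

/-- The crux without `¬ IsIrreducible` ("every compatible `ρ` makes `∧²π` induced").  FALSE for a
generic `π` (irreducible avatar, `∧²π` cuspidal by AR and not an automorphic induction — then no
`(L, P)` exists by JS strong multiplicity one for isobaric GL₆), but a witness is a genuine cuspidal
`π` on GL₄ with a known avatar: not constructible here, so no `_false_without_` theorem. [folklore] -/
def ReducibleInducesSquareWithoutReducible : Prop :=
  ∀ (K : Type) [Field K] [NumberField K] (h1 : isCompact_glFiniteIntegralLevel 1 K)
    (hcpt : isCompact_glFiniteIntegralLevel 4 K) (π : CuspidalAutomorphicRepData 4 K hcpt),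
    HeckeFieldHyp π → ¬ EssSelfDualHyp h1 π → ¬ SelfTwistedHyp π →
      ∀ (ℓ : ℕ) [Fact ℓ.Prime] (ι : PadicAlgCl ℓ ≃+* ℂ) (ρ : FramedGaloisRep K (PadicAlgCl ℓ) 4),
        ρ.toGaloisRep.IsSemisimple → CompatibleHyp π ι ρ → AIConclusion π

/-- `¬ SelfTwisted` is not needed for truth. [folklore] -/
theorem withoutNotSelfTwisted_of_conjecture (h : CuspidalImpliesIrreducibleGL4) :
    ReducibleInducesSquareWithoutNotSelfTwisted :=
  fun K _ _ _ hcpt π _ _ ℓ _ ι ρ _ hcomp hred => absurd (h K hcpt π ℓ ι ρ hcomp) hred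

/-- `¬ EssSelfDual` is not needed for truth. [folklore] -/
theorem withoutNotEssSelfDual_of_conjecture (h : CuspidalImpliesIrreducibleGL4) :
    ReducibleInducesSquareWithoutNotEssSelfDual :=
  fun K _ _ hcpt π _ _ ℓ _ ι ρ _ hcomp hred => absurd (h K hcpt π ℓ ι ρ hcomp) hred

/-- The Hecke field is not needed for truth. [folklore] -/
theorem withoutHeckeField_of_conjecture (h : CuspidalImpliesIrreducibleGL4) :
    ReducibleInducesSquareWithoutHeckeField :=
  fun K _ _ _ hcpt π _ _ ℓ _ ι ρ _ hcomp hred => absurd (h K hcpt π ℓ ι ρ hcomp) hred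

/-- Semisimplicity is not needed for truth. [folklore] -/
theorem withoutSemisimple_of_conjecture (h : CuspidalImpliesIrreducibleGL4) :
    ReducibleInducesSquareWithoutSemisimple :=
  fun K _ _ _ hcpt π _ _ _ ℓ _ ι ρ hcomp hred => absurd (h K hcpt π ℓ ι ρ hcomp) hred

/-- Each weakened variant implies the crux back (monotonicity bookkeeping). [folklore] -/
theorem reducibleInducesSquare_of_withoutNotSelfTwisted
    (h : ReducibleInducesSquareWithoutNotSelfTwisted) : ReducibleInducesSquare :=
  fun K _ _ h1 hcpt π hE hNE _ ℓ _ ι ρ hss hcomp hred => h K h1 hcpt π hE hNE ℓ ι ρ hss hcomp hred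

/-! ## §3  Targets

None received (payload.targets = [], stuck_stubs = []).  The registered `birth` stubs and the
picked `Sketch` line's stubs all keep "cuspidal `π` + compatible `ρ` of a reducible shape" among
their hypotheses, so §1–§2 apply verbatim: no stub is refutable without a genuine `π`.
The disprover's standing offer to the lead: if a stub is RESHAPED so that `π` or `ρ` disappears from
its hypotheses (e.g. a pure multiset / Euler-factor identity, a statement about all Hecke
characters, or a JS-type fact for Borel–Jacquet data), send it as `disprover-wanted:` — those have
finite or analytic content and can be attacked. -/

end

end Summit.Langlands.Langlands.Cruxes.ReducibleInducesSquare.Disproof
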